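import Literature.Barriers.ValiantsHypothesis.CT23ExplicitMatrixSquaring
import HarnessLib

/-!
# Powers `A^{2^j}` of an explicitly encoded matrix by iterated squaring with fresh workspace
# (Chatterjee–Tengse arXiv:2309.07612v2, Prop. 2.28 / Claim 38, the recursion `D_i ↦ D_{i+1}`;
# val-lit t18 g7, X-CT23 engine brick E-c′)

Theorem-only (plus plumbing `def`s) companion of `CT23ExplicitMatrixSquaring.lean`; NO named
facts. Honest framing: the iteration half of the source's "determinant of an explicit matrix in
`VPSPACE`" engine (v1 Prop. 36 / Claim 38, held text `paper:arxiv-2309.07612` p0013.txt:L18–L25: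
"Now for every `2 ≤ i ≤ k = log(N+1)`, we define `P_{i+1}` by using `D_i` in place of `C_A`, and
`D_{i+1}` by using `P_{i+1}` in place of `P_1` … all these increases are additive. So, finally,
`C'(x) = D_k(x,s,t)` has a circuit of size `O(size(C_A) + log² N)`"); it discharges nothing by
itself; `VP ≠ VNP` is NOT proved and nothing here bears on it.

## Rendering

Index blocks `a b : Fin L → τ` as in the squaring file; a supply of FRESH workspace, one block
`ws i : Fin L → τ` and one selector `zs i : τ` per level `i < K`, all distinct from each other
and from `a, b` (one injective map, `Supply`), none occurring in the encoder `E` nor projected by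
its circuit `C`. Then `powPoly j` (= `D_j`) iterates `sqPoly` with the level-`i` workspace and
**`matOf a b (powPoly … E j) = (matOf a b E) ^ (2 ^ j)`** (`matOf_powPoly`); `powCircuit C j`
iterates `sqCircuit` and computes `powPoly … E j` (`eval_powCircuit`) with
**size `= C.size + j · (11·L + 3)`** (`size_powCircuit`), fan-in two, sign constants, and projects
only the used workspace on top of `C` (`projVars_powCircuit_subset`). The variable bookkeeping
(`vars_sqPoly_subset`: `D₁` mentions no variable that `E` does not) is what makes the recursion
go through.

## References

* [ChatterjeeTengse2023] P. Chatterjee, A. Tengse, *Lower Bounds from Succinct Hitting Sets*,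
  arXiv:2309.07612v2, Prop. 2.28 / Claim 38 (v1: Prop. 36; p0013.txt:L9–L25).
-/

noncomputable section

open MvPolynomial

namespace Literature.Barriers.ValiantsHypothesis

open Literature.Computability.AlgebraicComplexity

universe u v

variable {k : Type u} [CommRing k] {τ : Type v} [DecidableEq τ] {L : ℕ}

/-! ### Variable bookkeeping: `D₁` mentions no new variable -/

section Vars

omit [DecidableEq τ] in
/-- `vars (X n) ⊆ {n}` without a nontriviality assumption. [folklore] -/
private theorem vars_X_subset' (n : τ) : (X n : MvPolynomial τ k).vars ⊆ {n} := by
  classical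
  intro v hv
  rw [MvPolynomial.vars_def, Multiset.mem_toFinset] at hv
  exact Finset.mem_singleton.2 (Multiset.mem_singleton.1 (Multiset.mem_of_le (degrees_X' n) hv))

/-- Variables after a substitution come from the substituted polynomials.
[cite: ChatterjeeTengse2023, Claim 38 (v1: p0013.txt:L18–L21)] -/
theorem mem_vars_aeval {f : τ → MvPolynomial τ k} {p : MvPolynomial τ k} {v : τ}
    (hv : v ∈ (aeval f p).vars) : ∃ i ∈ p.vars, v ∈ (f i).vars := by
  rw [MvPolynomial.aeval_eq_bind₁] at hv
  simpa using MvPolynomial.vars_bind₁ f p hv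

/-- A projection removes the projected variable and adds none.
[cite: ChatterjeeTengse2023, Def. 2.19 (v1: Def. 27)] -/
theorem mem_vars_projVar {i : τ} {c : k} {p : MvPolynomial τ k} {v : τ}
    (hv : v ∈ (projVar i c p).vars) : v ∈ p.vars ∧ v ≠ i := by
  obtain ⟨j, hj, hvj⟩ := mem_vars_aeval (f := fun j => if j = i then C c else X j) hv
  by_cases hji : j = i
  · simp [hji, MvPolynomial.vars_C] at hvj
  · simp only [hji, ↓reduceIte] at hvj
    have := Finset.mem_singleton.1 (vars_X_subset' j hvj)
    subst this
    exact ⟨hj, hji⟩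

/-- A production gate removes its variable and adds none. [cite: ChatterjeeTengse2023, Def. 2.23 (v1: Def. 30)] -/
theorem mem_vars_production {i : τ} {p : MvPolynomial τ k} {v : τ}
    (hv : v ∈ (production i p).vars) : v ∈ p.vars ∧ v ≠ i := by
  rw [production] at hv
  rcases Finset.mem_union.1 (MvPolynomial.vars_mul _ _ hv) with h | h
  · exact mem_vars_projVar h
  · exact mem_vars_projVar h

omit [DecidableEq τ] in
/-- Bits have no variables. [folklore] -/
private theorem vars_bit (c : Bool) : (bit c : MvPolynomial τ k).vars = ∅ := by
  unfold bit; split_ifs <;> simp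

/-- A Boolean sum over a block removes the block variables and adds none.
[cite: ChatterjeeTengse2023, Def. 2.23 (v1: Def. 30)] -/
theorem mem_vars_blkBoolSum {w : Fin L → τ} {Q : MvPolynomial τ k} {v : τ}
    (hv : v ∈ (blkBoolSum w L Q).vars) : v ∈ Q.vars ∧ ∀ l, w l ≠ v := by
  rw [blkBoolSum_eq_sum] at hv
  obtain ⟨κ, -, hκ⟩ := Finset.mem_biUnion.1 (MvPolynomial.vars_sum_subset _ _ hv)
  obtain ⟨j, hj, hvj⟩ := mem_vars_aeval hκ
  by_cases h : ∃ l, w l = j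
  · obtain ⟨l, rfl⟩ := h
    by_cases hw : Function.Injective w
    · rw [onBlock_blk hw, vars_bit] at hvj
      simp at hvj
    · -- a non-injective block: `onBlock` still yields a bit or `X`; both cases are harmless
      unfold onBlock at hvj
      split_ifs at hvj with h'
      · rw [vars_bit] at hvj; simp at hvj
      · exact absurd ⟨l, rfl⟩ h'
  · rw [onBlock_of_ne (fun l hl => h ⟨l, hl⟩)] at hvj
    have := Finset.mem_singleton.1 (vars_X_subset' j hvj)
    subst this
    exact ⟨hj, fun l hl => h ⟨l, hl⟩⟩

/-- The multiplexing substitution adds only the fresh `w`, `z`.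
[cite: ChatterjeeTengse2023, Claim 38 (v1: p0013.txt:L11)] -/
theorem mem_vars_aeval_muxSubst {a b w : Fin L → τ} {z : τ} (F : Fresh a b w z)
    {E : MvPolynomial τ k} {v : τ} (hv : v ∈ (aeval (muxSubst (k := k) a b w z) E).vars) :
    v ∈ E.vars ∨ (∃ l, w l = v) ∨ v = z := by
  obtain ⟨j, hj, hvj⟩ := mem_vars_aeval hv
  have hX : ∀ {n : τ}, v ∈ (X n : MvPolynomial τ k).vars → v = n := fun h =>
    Finset.mem_singleton.1 (vars_X_subset' _ h)
  have hsm : ∀ n : τ, ((-1 : k) • X n : MvPolynomial τ k) = -X n := fun n => neg_one_smul k _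
  by_cases ha : ∃ l, a l = j
  · obtain ⟨l, rfl⟩ := ha
    rw [muxSubst, onBlock_blk F.a_inj, muxA, hsm] at hvj
    rcases Finset.mem_union.1 (MvPolynomial.vars_add_subset _ _ hvj) with h | h
    · exact Or.inl (hX h ▸ hj)
    · rcases Finset.mem_union.1 (MvPolynomial.vars_mul _ _ h) with h | h
      · rcases Finset.mem_union.1 (MvPolynomial.vars_add_subset _ _ h) with h | h
        · exact Or.inr (Or.inl ⟨l, (hX h).symm⟩)
        · rw [MvPolynomial.vars_neg] at h; exact Or.inl (hX h ▸ hj)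
      · exact Or.inr (Or.inr (hX h))
  · have ha' : ∀ l, a l ≠ j := fun l hl => ha ⟨l, hl⟩
    by_cases hb : ∃ l, b l = j
    · obtain ⟨l, rfl⟩ := hb
      rw [muxSubst, onBlock_of_ne ha', onBlock_blk F.b_inj, muxB, hsm] at hvj
      rcases Finset.mem_union.1 (MvPolynomial.vars_add_subset _ _ hvj) with h | h
      · exact Or.inr (Or.inl ⟨l, (hX h).symm⟩)
      · rcases Finset.mem_union.1 (MvPolynomial.vars_mul _ _ h) with h | h
        · rcases Finset.mem_union.1 (MvPolynomial.vars_add_subset _ _ h) with h | h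
          · exact Or.inl (hX h ▸ hj)
          · rw [MvPolynomial.vars_neg] at h; exact Or.inr (Or.inl ⟨l, (hX h).symm⟩)
        · exact Or.inr (Or.inr (hX h))
    · have hb' : ∀ l, b l ≠ j := fun l hl => hb ⟨l, hl⟩
      rw [muxSubst, onBlock_of_ne ha', onBlock_of_ne hb'] at hvj
      exact Or.inl (hX hvj ▸ hj)

/-- **`D₁` mentions no variable that `E` does not** (the workspace `w, z` is bound).
[cite: ChatterjeeTengse2023, Claim 38 (v1: p0013.txt:L11–L21)] -/
theorem vars_sqPoly_subset {a b w : Fin L → τ} {z : τ} (F : Fresh a b w z) (E : MvPolynomial τ k) :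
    (sqPoly a b w z E).vars ⊆ E.vars := by
  intro v hv
  rw [sqPoly] at hv
  obtain ⟨hv1, hvw⟩ := mem_vars_blkBoolSum hv
  obtain ⟨hv2, hvz⟩ := mem_vars_production hv1
  rcases mem_vars_aeval_muxSubst F hv2 with h | ⟨l, hl⟩ | h
  · exact h
  · exact absurd hl (hvw l)
  · exact absurd h hvz

end Vars

/-! ### Iterated squaring with a supply of fresh workspace -/

section Powering

variable {K : ℕ}

/-- A SUPPLY of fresh workspace for `K` squaring levels: index blocks `a, b`, and for each level
`i < K` a block `ws i` and a selector `zs i`, all pairwise distinct (one injective map).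
[cite: ChatterjeeTengse2023, Claim 38 (v1: p0013.txt:L18–L21)] -/
structure Supply (a b : Fin L → τ) (ws : Fin K → Fin L → τ) (zs : Fin K → τ) : Prop where
  /-- all of `a, b, ws i l, zs i` are pairwise distinct variables -/
  inj : Function.Injective
    (Sum.elim (Sum.elim a b) (Sum.elim (fun p : Fin K × Fin L => ws p.1 p.2) zs))

namespace Supply

variable {a b : Fin L → τ} {ws : Fin K → Fin L → τ} {zs : Fin K → τ} (S : Supply a b ws zs)
include S

omit [DecidableEq τ] in
/-- Each level is `Fresh`. [cite: ChatterjeeTengse2023, Claim 38 (v1: p0013.txt:L18–L21)] -/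
theorem fresh (i : Fin K) : Fresh a b (ws i) (zs i) := by
  refine ⟨fun x y hxy => ?_⟩
  -- transport through the big injective map
  let emb : (Fin L ⊕ Fin L) ⊕ (Fin L ⊕ Unit) → (Fin L ⊕ Fin L) ⊕ (Fin K × Fin L ⊕ Fin K) :=
    Sum.map id (Sum.map (fun l => (i, l)) fun _ => i)
  have hemb : Function.Injective emb := by
    refine Sum.map_injective.2 ⟨Function.injective_id, Sum.map_injective.2 ⟨?_, ?_⟩⟩
    · intro l l' h; simpa using h
    · intro u u' _; cases u; cases u'; rfl
  have key : ∀ x, Sum.elim (Sum.elim a b) (Sum.elim (ws i) fun _ : Unit => zs i) x =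
      Sum.elim (Sum.elim a b) (Sum.elim (fun p : Fin K × Fin L => ws p.1 p.2) zs) (emb x) := by
    rintro ((l | l) | (l | u)) <;> rfl
  rw [key, key] at hxy
  exact hemb (S.inj hxy)

omit [DecidableEq τ] in
/-- Later workspace blocks miss earlier ones. [cite: ChatterjeeTengse2023, Claim 38 (v1: p0013.txt:L18–L21)] -/
theorem ws_ne_ws {i j : Fin K} (hij : i ≠ j) (l l' : Fin L) : ws i l ≠ ws j l' := fun h => by
  have := @S.inj (Sum.inr (Sum.inl (i, l))) (Sum.inr (Sum.inl (j, l'))) (by simpa using h)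
  simp only [Sum.inr.injEq, Sum.inl.injEq, Prod.mk.injEq] at this
  exact hij this.1

omit [DecidableEq τ] in
/-- Workspace blocks miss selectors. [cite: ChatterjeeTengse2023, Claim 38 (v1: p0013.txt:L18–L21)] -/
theorem ws_ne_zs (i j : Fin K) (l : Fin L) : ws i l ≠ zs j := fun h => by
  have := @S.inj (Sum.inr (Sum.inl (i, l))) (Sum.inr (Sum.inr j)) (by simpa using h)
  simp at this

omit [DecidableEq τ] in
/-- Distinct selectors. [cite: ChatterjeeTengse2023, Claim 38 (v1: p0013.txt:L18–L21)] -/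
theorem zs_ne_zs {i j : Fin K} (hij : i ≠ j) : zs i ≠ zs j := fun h => by
  have := @S.inj (Sum.inr (Sum.inr i)) (Sum.inr (Sum.inr j)) (by simpa using h)
  simp only [Sum.inr.injEq] at this
  exact hij this

omit [DecidableEq τ] in
/-- `a` misses the workspace. [cite: ChatterjeeTengse2023, Claim 38 (v1: p0013.txt:L18–L21)] -/
theorem a_ne_ws (l : Fin L) (i : Fin K) (l' : Fin L) : a l ≠ ws i l' := (S.fresh i).a_ne_w l l'

omit [DecidableEq τ] in
/-- `b` misses the workspace. [cite: ChatterjeeTengse2023, Claim 38 (v1: p0013.txt:L18–L21)] -/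
theorem b_ne_ws (l : Fin L) (i : Fin K) (l' : Fin L) : b l ≠ ws i l' := (S.fresh i).b_ne_w l l'

omit [DecidableEq τ] in
/-- `a` misses the selectors. [cite: ChatterjeeTengse2023, Claim 38 (v1: p0013.txt:L18–L21)] -/
theorem a_ne_zs (l : Fin L) (i : Fin K) : a l ≠ zs i := (S.fresh i).a_ne_z l

omit [DecidableEq τ] in
/-- `b` misses the selectors. [cite: ChatterjeeTengse2023, Claim 38 (v1: p0013.txt:L18–L21)] -/
theorem b_ne_zs (l : Fin L) (i : Fin K) : b l ≠ zs i := (S.fresh i).b_ne_z l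

end Supply

variable (a b : Fin L → τ) (ws : Fin K → Fin L → τ) (zs : Fin K → τ)

/-- **`D_j`**: `j`-fold iterated squaring polynomial (level `i` uses workspace `ws i, zs i`).
[cite: ChatterjeeTengse2023, Claim 38 "`D_{i+1}` by using `P_{i+1}` in place of `P_1`" (v1: p0013.txt:L18–L21)] -/
def powPoly (E : MvPolynomial τ k) : ℕ → MvPolynomial τ k
  | 0 => E
  | j + 1 => if h : j < K then sqPoly a b (ws ⟨j, h⟩) (zs ⟨j, h⟩) (powPoly E j) else powPoly E j

/-- **The circuit for `D_j`**: `j`-fold iterated `sqCircuit`.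
[cite: ChatterjeeTengse2023, Claim 38 (v1: p0013.txt:L18–L25)] -/
def powCircuit (C : ProjCircuit k τ) : ℕ → ProjCircuit k τ
  | 0 => C
  | j + 1 => if h : j < K then sqCircuit a b (ws ⟨j, h⟩) (zs ⟨j, h⟩) (powCircuit C j)
      else powCircuit C j

variable {a b ws zs}

/-- `D_j` mentions no variable that `E` does not. [cite: ChatterjeeTengse2023, Claim 38 (v1: p0013.txt:L18–L21)] -/
theorem vars_powPoly_subset (S : Supply a b ws zs) (E : MvPolynomial τ k) (j : ℕ) :
    (powPoly a b ws zs E j).vars ⊆ E.vars := by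
  induction j with
  | zero => exact subset_rfl
  | succ j ih =>
    rw [powPoly]
    split_ifs with h
    · exact (vars_sqPoly_subset (S.fresh ⟨j, h⟩) _).trans ih
    · exact ih

/-- **`D_j` encodes `A^{2^j}`.** [cite: ChatterjeeTengse2023, Claim 38 "we can … obtain access to the entries of `A^{2^k}` for any `k`" (v1: p0012.txt:L78–L80, p0013.txt:L14–L21)] -/
theorem matOf_powPoly (S : Supply a b ws zs) {E : MvPolynomial τ k}
    (hEw : ∀ i l, ws i l ∉ E.vars) (hEz : ∀ i, zs i ∉ E.vars) {j : ℕ} (hj : j ≤ K) :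
    matOf a b (powPoly a b ws zs E j) = matOf a b E ^ 2 ^ j := by
  induction j with
  | zero => simp [powPoly]
  | succ j ih =>
    have hj' : j < K := by omega
    rw [powPoly, dif_pos hj', matOf_sqPoly (S.fresh ⟨j, hj'⟩), ih hj'.le, pow_succ, pow_mul, sq]
    · exact fun l h => hEw _ l (vars_powPoly_subset S E j h)
    · exact fun h => hEz _ (vars_powPoly_subset S E j h)

/-- What the iterated circuit projects: `C`'s projections plus the used workspace.
[cite: ChatterjeeTengse2023, Claim 38 (v1: p0013.txt:L18–L21)] -/
theorem projVars_powCircuit_subset (C : ProjCircuit k τ) (j : ℕ) :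
    (powCircuit a b ws zs C j).projVars ⊆
      C.projVars ∪ {v | (∃ (i : Fin K) (l : Fin L), i.val < j ∧ ws i l = v) ∨
        ∃ i : Fin K, i.val < j ∧ zs i = v} := by
  induction j with
  | zero => exact fun v hv => Or.inl hv
  | succ j ih =>
    rw [powCircuit]
    split_ifs with h
    · intro v hv
      rcases projVars_sqCircuit_subset _ hv with hv | hv | ⟨l, rfl⟩
      · rcases ih hv with hv | ⟨⟨i, l, hi, rfl⟩ | ⟨i, hi, rfl⟩⟩
        · exact Or.inl hv
        · exact Or.inr (Or.inl ⟨i, l, by omega, rfl⟩)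
        · exact Or.inr (Or.inr ⟨i, by omega, rfl⟩)
      · exact Or.inr (Or.inr ⟨⟨j, h⟩, Nat.lt_succ_self j, (Set.mem_singleton_iff.1 hv).symm⟩)
      · exact Or.inr (Or.inl ⟨⟨j, h⟩, l, Nat.lt_succ_self j, rfl⟩)
    · exact fun v hv => (ih hv).elim Or.inl fun h' => Or.inr (h'.elim
        (fun ⟨i, l, hi, h⟩ => Or.inl ⟨i, l, by omega, h⟩) fun ⟨i, hi, h⟩ => Or.inr ⟨i, by omega, h⟩)

/-- **The iterated circuit computes `D_j`.** [cite: ChatterjeeTengse2023, Claim 38 (v1: p0013.txt:L18–L25)] -/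
theorem eval_powCircuit (S : Supply a b ws zs) {C : ProjCircuit k τ} {E : MvPolynomial τ k}
    (hCE : C.Computes E)
    (hC : ∀ v ∈ C.projVars, (∀ l, a l ≠ v) ∧ (∀ l, b l ≠ v) ∧ (∀ i l, ws i l ≠ v) ∧ ∀ i, zs i ≠ v)
    {j : ℕ} (hj : j ≤ K) :
    (powCircuit a b ws zs C j).eval = powPoly a b ws zs E j := by
  induction j with
  | zero => exact hCE
  | succ j ih =>
    have hj' : j < K := by omega
    rw [powCircuit, dif_pos hj', powPoly, dif_pos hj']
    refine eval_sqCircuit (S.fresh ⟨j, hj'⟩) (ih hj'.le) fun v hv => ?_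
    rcases projVars_powCircuit_subset C j hv with hv | ⟨i, l, hi, rfl⟩ | ⟨i, hi, rfl⟩
    · obtain ⟨h1, h2, h3, h4⟩ := hC v hv
      exact ⟨h1, h2, h3 _, (h4 _).symm⟩
    · have hne : (⟨j, hj'⟩ : Fin K) ≠ i := fun h => by rw [← h] at hi; exact lt_irrefl _ hi
      refine ⟨fun l' => S.a_ne_ws l' i l, fun l' => S.b_ne_ws l' i l, fun l' => ?_, ?_⟩
      · exact S.ws_ne_ws hne l' l
      · exact S.ws_ne_zs i ⟨j, hj'⟩ l
    · have hne : (⟨j, hj'⟩ : Fin K) ≠ i := fun h => by rw [← h] at hi; exact lt_irrefl _ hi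
      refine ⟨fun l' => S.a_ne_zs l' i, fun l' => S.b_ne_zs l' i, fun l' => ?_, ?_⟩
      · exact S.ws_ne_zs ⟨j, hj'⟩ i l'
      · exact (S.zs_ne_zs hne).symm

omit [DecidableEq τ] in
/-- **Size: additive, `11L + 3` per level** ("all these increases are additive … `O(size(C_A) + log² N)`").
[cite: ChatterjeeTengse2023, Claim 38 (v1: p0013.txt:L22–L25)] -/
theorem size_powCircuit [DecidableEq τ] (C : ProjCircuit k τ) {j : ℕ} (hj : j ≤ K) :
    (powCircuit a b ws zs C j).size = C.size + j * (11 * L + 3) := by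
  induction j with
  | zero => simp [powCircuit]
  | succ j ih =>
    have hj' : j < K := by omega
    rw [powCircuit, dif_pos hj', size_sqCircuit, ih hj'.le]
    ring

/-- Fan-in two is kept. [cite: ChatterjeeTengse2023, Claim 38 (v1: p0013.txt:L22–L25)] -/
theorem isFanInTwo_powCircuit {C : ProjCircuit k τ} (hC : C.IsFanInTwo) (j : ℕ) :
    (powCircuit a b ws zs C j).IsFanInTwo := by
  induction j with
  | zero => exact hC
  | succ j ih =>
    rw [powCircuit]
    split_ifs
    · exact isFanInTwo_sqCircuit ih
    · exact ih

/-- Constant-freeness is kept. [cite: ChatterjeeTengse2023, Claim 38 (v1: p0013.txt:L25)] -/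
theorem hasSignConstants_powCircuit {C : ProjCircuit k τ} (hC : C.HasSignConstants) (j : ℕ) :
    (powCircuit a b ws zs C j).HasSignConstants := by
  induction j with
  | zero => exact hC
  | succ j ih =>
    rw [powCircuit]
    split_ifs
    · exact hasSignConstants_sqCircuit ih
    · exact ih

end Powering

end Literature.Barriers.ValiantsHypothesis
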